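import Summits.Ventures.PercRepro.S1CoreCapSpec
import Mathlib.Data.Finset.Powerset

/-!
# PercRepro — the 4-circuit-cap spec is a finite problem: `|V| ≤ 3ν` (p1, gen 22; the s₄ seat)

`proofs/P1-S4-CAPBRIDGE.md` §1 / §8. In any configuration admitted by `FourCap.FourCapSpec` (lines of `≥ 3` points,
the cost clause `wsum (unionL l) ≤ ν + lineRank l`), the points on the lines number at most `3ν`: each line's
increment to `lineRank` is at most two thirds of its new points (`3 · inc ≤ 2 · new`: an isolated line adds `≤ 2` for
`≥ 3` points, a line meeting the union in one point adds `≤ 1` for `≥ 2`, a line meeting it in `≥ 2` adds `0`), so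
`3 · lineRank l ≤ 2 · |unionL l|` and `|unionL l| ≤ wsum ≤ ν + lineRank l ≤ ν + (2/3)|unionL l|`. Hence the searches
(fourcap.py, fourcap.c, fourcap_brute.py) enumerate a finite set: configurations on `≤ 3ν` points, with at most
`C(3ν, 2)/3` lines (two lines share `≤ 1` point). Nothing here is about matroids. Axioms: standard.
-/

namespace PercRepro

namespace S1

namespace FourCap

variable {β : Type} [DecidableEq β]

/-- Each line's increment is at most two thirds of its new points (lines have `≥ 3` points). -/
theorem three_mul_lineRank_le (l : List (Finset β)) (h3 : ∀ L ∈ l, 3 ≤ L.card) :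
    3 * lineRank l ≤ 2 * (unionL l).card := by
  induction l with
  | nil => simp [lineRank, unionL]
  | cons L l ih =>
    have ih' := ih (fun L' hL' => h3 L' (List.mem_cons_of_mem _ hL'))
    have hL3 := h3 L List.mem_cons_self
    have hsd : (L \ unionL l).card + (L ∩ unionL l).card = L.card := by
      rw [Finset.card_sdiff, Finset.inter_comm]
      exact Nat.sub_add_cancel (Finset.card_le_card Finset.inter_subset_left)
    have hun : (L ∪ unionL l).card + (L ∩ unionL l).card = L.card + (unionL l).card :=
      Finset.card_union_add_card_inter L (unionL l)
    simp only [lineRank, unionL]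
    omega

/-- **The spec is finite**: under the cost clause at nullity `ν`, a list of lines of `≥ 3` points covers at most `3ν`
points. -/
theorem card_unionL_le_three_mul (w : β → ℕ) (hw : ∀ v, 1 ≤ w v) (l : List (Finset β)) (h3 : ∀ L ∈ l, 3 ≤ L.card)
    {ν : ℕ} (hcost : wsum w (unionL l) ≤ ν + lineRank l) : (unionL l).card ≤ 3 * ν := by
  have h1 := three_mul_lineRank_le l h3
  have h2 : (unionL l).card ≤ wsum w (unionL l) := by
    unfold wsum
    rw [Finset.card_eq_sum_ones]
    exact Finset.sum_le_sum (fun v _ => hw v)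
  omega

/-- The same, for the weights of a configuration (`1` or `2` on the points of lines). -/
theorem card_unionL_le_three_mul_of_config {w : β → ℕ} {ls : Finset (Finset β)}
    (h1 : ∀ L ∈ ls, ∀ v ∈ L, w v = 1 ∨ w v = 2) (h2 : ∀ L ∈ ls, 3 ≤ L.card ∧ wsum w L ≤ 5) {ν : ℕ}
    (h4 : ∀ l : List (Finset β), l.Nodup → (∀ L ∈ l, L ∈ ls) → wsum w (unionL l) ≤ ν + lineRank l)
    (l : List (Finset β)) (hl : l.Nodup) (hls : ∀ L ∈ l, L ∈ ls) : (unionL l).card ≤ 3 * ν := by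
  have h3 : ∀ L ∈ l, 3 ≤ L.card := fun L hL => (h2 L (hls L hL)).1
  have hr := three_mul_lineRank_le l h3
  have hc : (unionL l).card ≤ wsum w (unionL l) := by
    unfold wsum
    rw [Finset.card_eq_sum_ones]
    refine Finset.sum_le_sum (fun v hv => ?_)
    obtain ⟨L, hL, hvL⟩ := mem_unionL_iff.1 hv
    rcases h1 L (hls L hL) v hvL with h | h <;> omega
  have := h4 l hl hls
  omega

/-- **Pair counting**: lines sharing at most one point have disjoint pair sets, so `Σ_L C(|L|, 2) ≤ C(|V|, 2)` with
`V = ls.biUnion id` the points on the lines. -/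
theorem sum_choose_two_le (ls : Finset (Finset β)) (hpair : ∀ L ∈ ls, ∀ L' ∈ ls, L ≠ L' → (L ∩ L').card ≤ 1) :
    ∑ L ∈ ls, L.card.choose 2 ≤ (ls.biUnion id).card.choose 2 := by
  have hdisj : (ls : Set (Finset β)).PairwiseDisjoint (fun L => L.powersetCard 2) := by
    intro L hL L' hL' hne
    rw [Function.onFun, Finset.disjoint_left]
    intro P hP hP'
    rw [Finset.mem_powersetCard] at hP hP'
    have hsub : P ⊆ L ∩ L' := Finset.subset_inter hP.1 hP'.1
    have := (Finset.card_le_card hsub).trans (hpair L hL L' hL' hne)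
    omega
  calc ∑ L ∈ ls, L.card.choose 2 = ∑ L ∈ ls, (L.powersetCard 2).card := by
        refine Finset.sum_congr rfl (fun L _ => ?_); rw [Finset.card_powersetCard]
    _ = (ls.biUnion (fun L => L.powersetCard 2)).card := (Finset.card_biUnion hdisj).symm
    _ ≤ ((ls.biUnion id).powersetCard 2).card := by
        refine Finset.card_le_card ?_
        intro P hP
        rw [Finset.mem_biUnion] at hP
        obtain ⟨L, hL, hPL⟩ := hP
        rw [Finset.mem_powersetCard] at hPL ⊢
        exact ⟨hPL.1.trans (Finset.subset_biUnion_of_mem id hL), hPL.2⟩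
    _ = (ls.biUnion id).card.choose 2 := Finset.card_powersetCard _ _

/-- **The number of lines is bounded**: `3 · |ls| ≤ C(|V|, 2)` (every line has `≥ 3` points, hence `≥ 3` pairs). -/
theorem three_mul_card_le_choose (ls : Finset (Finset β)) (h3 : ∀ L ∈ ls, 3 ≤ L.card)
    (hpair : ∀ L ∈ ls, ∀ L' ∈ ls, L ≠ L' → (L ∩ L').card ≤ 1) :
    3 * ls.card ≤ (ls.biUnion id).card.choose 2 := by
  refine le_trans ?_ (sum_choose_two_le ls hpair)
  have h := Finset.card_nsmul_le_sum ls (fun L => L.card.choose 2) 3 (fun L hL => by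
    have := h3 L hL
    calc 3 = Nat.choose 3 2 := by decide
      _ ≤ L.card.choose 2 := Nat.choose_le_choose 2 this)
  have h' : ls.card * 3 ≤ ∑ L ∈ ls, L.card.choose 2 := by simpa using h
  omega

end FourCap


end S1

end PercRepro
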